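import Summits.QuantumFields.YangMills.Theorems.LuscherReductionTwistedTraceScalingFPWeightCoreAt
import HarnessLib

/-!
# ★★★ THE FADDEEV–POPOV WEIGHT IS CONSTANT ON THE BORN–OPPENHEIMER CORE to relative `O(δ²)` — eventually in `β`, and the record instance
# (lane A of S-BASE, crux `TwistedTraceScaling` stmt-QuantumFields-20203, C4 INNER; design note `pub/ym-fleet/ym-luscher-20007-p1/COARSE-DESIGN.md` §23.12 owe (P))

Packaging of `fpWeight_core_at` (`…FPWeightCoreAt`): the L-dependent constants are supplied by the lineage's existence theorems (`exists_slicePoint` p628969,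
`exists_taylor_two_basedFn` p632921, `exists_uniform_coercive_basedLin` p634162, `laplaceIntegral_eq` p638140, `exists_gramDet_ratio_bound` p637998,
`eventually_norm_basedLin_sub_le` p634162) and the sixteen smallness conditions hold eventually because `δ → 0`.
* ★★★ `fpWeight_core_constant` — for scales `δ → 0` (all `δ β > 0`), `0 < δg ≤ δ³` eventually: `∃ M₀ ≥ 2, ∀ M ≥ M₀, ∃ C ≥ 0, β₀, ∀ β ≥ β₀, ∀ U ∈ fatTubeRho δ (M·δ) β`,
  `N̄(δg β)(1 − Cδ(β)²) ≤ gaugeAvg (recordWeightRho δ (M·δ) δg β) U ≤ N̄(δg β)(1 + Cδ(β)²)` (`N̄ = fpWeightBar`);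
* ★★★ `fpWeight_core_constant_pow` — the record instance `δ = powScale σ = β^{-σ}`, `δg = powScale 1 = β^{-1}`, `0 < σ ≤ 1/3` (covers the window `σ ∈ (1/6, 1/5)`): the
  Faddeev–Popov weight of the tube of record is constant on the fat tube to relative `O(β^{-2σ})` — `o(λ_b)` iff `σ > 1/6` (R25's line; cdisprove `second_order_line_iff`).
So in every Rayleigh quotient `⟨f, K̃_β f⟩ / ∫ f²·(N/χ)` of the slice problem (`…GaugeSlice`, `…InnerOfSoftTube`) the weight `N` may be replaced by the constant `N̄(β^{-1})` at
relative cost `O(β^{-2σ})`: the (N) chapter of COARSE-DESIGN §23 is closed.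
HONEST FRAMING: bookkeeping for a stub of a child of the CONDITIONAL reduction route R2b1; no spectral claim; C4 OPEN; not a gap, not Clay.
-/

set_option autoImplicit false

noncomputable section

open MeasureTheory Filter Topology Real Module
open scoped BigOperators
open Literature.MathematicalPhysics.QuantumFieldTheory
open Literature.MathematicalPhysics.QuantumLattice

namespace Summit.QuantumFields.YangMills.Theorems.FemtoTransferGap.TwoLattice.ConstTube

open Summit.QuantumFields.YangMills.Theorems.FemtoTransferGap
open Summit.QuantumFields.YangMills.Theorems.FemtoTransferGap.TwoLattice.Avg
open Summit.QuantumFields.YangMills.Theorems.FemtoTransferGap.TwoLattice.Stiff (LinkSpace)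

variable (L : ℕ) [NeZero L]

/-! ## §1 ★★★ The eventually-in-β statement -/

/-- `a·δ(β) ≤ c` eventually when `δ → 0` and `c > 0`. [folklore] -/
theorem eventually_mul_le_of_tendsto {δ : ℝ → ℝ} (hδ : Tendsto δ atTop (𝓝 0)) (a : ℝ) {c : ℝ} (hc : 0 < c) : ∀ᶠ β in atTop, a * δ β ≤ c := by
  have h := hδ.const_mul a
  rw [mul_zero] at h
  exact h.eventually (eventually_le_nhds hc)

/-- `a·δ(β) < c` eventually when `δ → 0` and `c > 0`. [folklore] -/
theorem eventually_mul_lt_of_tendsto {δ : ℝ → ℝ} (hδ : Tendsto δ atTop (𝓝 0)) (a : ℝ) {c : ℝ} (hc : 0 < c) : ∀ᶠ β in atTop, a * δ β < c := by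
  have h := hδ.const_mul a
  rw [mul_zero] at h
  exact h.eventually (eventually_lt_nhds hc)

/-- ★★★ **THE FADDEEV–POPOV WEIGHT IS CONSTANT ON THE CORE TO RELATIVE `O(δ²)`** (eventually in `β`, for any scales `δ → 0`, `0 < δg ≤ δ³`, fat radius `M·δ` with
`M ≥ M₀(L)`): `N̄(δg β)(1 − Cδ(β)²) ≤ gaugeAvg (recordWeightRho δ (M·δ) δg β) U ≤ N̄(δg β)(1 + Cδ(β)²)` for every `U` in the fat tube. [cite: Luscher1983, §3] -/
theorem fpWeight_core_constant (hL : Nonempty (NzSite L)) {δ δg : ℝ → ℝ} (hδ0 : ∀ β, 0 < δ β) (hδ : Tendsto δ atTop (𝓝 0))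
    (hsd : ∀ᶠ β in atTop, 0 < δg β ∧ δg β ≤ δ β ^ 3) :
    ∃ M₀ : ℝ, 2 ≤ M₀ ∧ ∀ M : ℝ, M₀ ≤ M → ∃ C β₀ : ℝ, 0 ≤ C ∧ ∀ β : ℝ, β₀ ≤ β →
      ∀ U ∈ fatTubeRho L δ (fun b => M * δ b) β,
        fpWeightBar L (δg β) * (1 - C * δ β ^ 2) ≤ gaugeAvg (recordWeightRho L δ (fun b => M * δ b) δg β) U ∧
          gaugeAvg (recordWeightRho L δ (fun b => M * δ b) δg β) U ≤ fpWeightBar L (δg β) * (1 + C * δ β ^ 2) := by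
  -- the constants of the lineage
  obtain ⟨K, ε, hK, hε, hSP⟩ := exists_slicePoint L
  obtain ⟨M_T, ε_T, hMT, hεT, hT⟩ := exists_taylor_two_basedFn L
  obtain ⟨ε_C, hεC, hC⟩ := exists_uniform_coercive_basedLin L
  obtain ⟨ε_I, hεI, hI'⟩ := Metric.eventually_nhds_iff.mp (laplaceIntegral_eq L)
  have hI : ∀ q : balancedSubmodule L × (Fin 3 → Fin 3 → ℝ), ‖q‖ < ε_I → ∀ {a s : ℝ}, 0 < a → 0 < s →
      ∫ w, Real.exp (-(a * ‖laplaceMap L q w‖ ^ 2 / s ^ 2)) ∂(volume : Measure (NzSite L → Fin 3 → ℝ)) =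
        (π * s ^ 2 / a) ^ (finrank ℝ (EuclideanSpace ℝ (NzSite L × Fin 3)) / 2 : ℝ) / Real.sqrt (gramDet L q) :=
    fun q hq => hI' (by rwa [dist_zero_right])
  obtain ⟨K_D, ε_D, hKD, hεD, hD⟩ := exists_gramDet_ratio_bound L
  -- a bound on `‖basedLin p‖` near `0` (from the `O(‖p‖)` Lipschitz estimate of `…SliceCoerciveBased`)
  obtain ⟨ε_B', hεB', hball⟩ := Metric.eventually_nhds_iff.mp (eventually_norm_basedLin_sub_le L)
  set RB : ℝ := 1144 * Real.sqrt (3 * Fintype.card (Edge 3 L)) with hRB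
  have hRB0 : 0 ≤ RB := by rw [hRB]; positivity
  set ε_B : ℝ := min ε_B' (1 / (RB + 1)) with hεBdef
  have hεB : 0 < ε_B := lt_min hεB' (by positivity)
  set B : ℝ := ‖basedLin L 0‖ + 1 with hBdef
  have hB0 : 0 ≤ B := by positivity
  have hB : ∀ q : balancedSubmodule L × (Fin 3 → Fin 3 → ℝ), ‖q‖ < ε_B → ‖basedLin L q‖ ≤ B := fun q hq => by
    have hq1 : ‖q‖ < ε_B' := lt_of_lt_of_le hq (min_le_left _ _)
    have hq2 : ‖q‖ < 1 / (RB + 1) := lt_of_lt_of_le hq (min_le_right _ _)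
    have hop : ‖basedLin L q - basedLin L 0‖ ≤ RB * ‖q‖ :=
      ContinuousLinearMap.opNorm_le_bound _ (by positivity) fun ξ => by
        have := hball (by rwa [dist_zero_right]) ξ; rw [hRB]; linarith
    have hRq : RB * ‖q‖ ≤ 1 := by
      have h1 : RB * ‖q‖ ≤ RB * (1 / (RB + 1)) := mul_le_mul_of_nonneg_left hq2.le hRB0
      have h2 : RB * (1 / (RB + 1)) ≤ 1 := by rw [mul_one_div, div_le_one (by positivity)]; linarith
      exact h1.trans h2
    have h3 := norm_le_insert' (basedLin L q) (basedLin L 0)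
    rw [hBdef]; linarith
  have hCpos := sliceConst_pos L
  refine ⟨3 + 16 * K, by linarith, fun M hM => ?_⟩
  -- the two error constants
  set Clo : ℝ := 6 * (Fintype.card (NzSite L) : ℝ) * (3 * ((L : ℝ) - 1) * (2 + 16 * K + M) + 1) ^ 2 +
      (flatDim L / 2 : ℝ) * (12 * sliceConst L * (M_T + 2 * B)) + (2 : ℝ) ^ (flatDim L / 2 : ℝ) * (32 * sliceConst L ^ 2) +
      K_D * (2 + 32 * K) ^ 2 with hClo
  set Chi : ℝ := 2 * (4 * (flatDim L / 2 : ℝ) * (12 * sliceConst L * (M_T + 2 * B)) + (4 : ℝ) ^ (flatDim L / 2 : ℝ) * (64 * sliceConst L ^ 2)) +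
      K_D * (2 + 32 * K) ^ 2 with hChi
  have hClo0 : 0 ≤ Clo := by rw [hClo]; positivity
  have hChi0 : 0 ≤ Chi := by rw [hChi]; positivity
  -- eventually all smallness conditions hold
  have ev : ∀ᶠ β in atTop, ∀ U ∈ fatTubeRho L δ (fun b => M * δ b) β,
      fpWeightBar L (δg β) * (1 - (Clo + Chi) * δ β ^ 2) ≤ gaugeAvg (recordWeightRho L δ (fun b => M * δ b) δg β) U ∧
        gaugeAvg (recordWeightRho L δ (fun b => M * δ b) δg β) U ≤ fpWeightBar L (δg β) * (1 + (Clo + Chi) * δ β ^ 2) := by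
    filter_upwards [hδ.eventually (eventually_le_nhds (by norm_num : (0:ℝ) < 1 / 8)), hδ.eventually (eventually_le_nhds (by positivity : (0:ℝ) < ε / 4)),
      eventually_mul_le_of_tendsto hδ (2 * K) (by norm_num : (0:ℝ) < 1 / 2), eventually_mul_le_of_tendsto hδ (1 + 16 * K) (by norm_num : (0:ℝ) < 1 / 4),
      eventually_mul_lt_of_tendsto hδ (2 + 32 * K) hεT, eventually_mul_lt_of_tendsto hδ (2 + 32 * K) hεC, eventually_mul_lt_of_tendsto hδ (2 + 32 * K) hεI,
      eventually_mul_lt_of_tendsto hδ (2 + 32 * K) hεD, eventually_mul_lt_of_tendsto hδ (2 + 32 * K) hεB,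
      eventually_mul_le_of_tendsto hδ (2 + 32 * K) (by norm_num : (0:ℝ) < 1 / 40),
      eventually_mul_lt_of_tendsto hδ (3 * ((L : ℝ) - 1) * (2 + 16 * K + M) + 1) hεT,
      eventually_mul_le_of_tendsto hδ (4 * sliceConst L * (M_T + 2 * B) * (3 * ((L : ℝ) - 1) * (2 + 16 * K + M) + 1)) (by norm_num : (0:ℝ) < 1 / 4),
      eventually_mul_le_of_tendsto hδ ((flatDim L / 2 + 1 : ℝ) * (12 * sliceConst L * (M_T + 2 * B))) (by norm_num : (0:ℝ) < 1 / 4),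
      eventually_mul_le_of_tendsto hδ ((2 : ℝ) ^ (flatDim L / 2 : ℝ) * (32 * sliceConst L ^ 2)) (by norm_num : (0:ℝ) < 1 / 4),
      eventually_mul_le_of_tendsto hδ (6 * (Fintype.card (NzSite L) : ℝ) * (3 * ((L : ℝ) - 1) * (2 + 16 * K + M) + 1) ^ 2) one_pos,
      eventually_mul_le_of_tendsto hδ (K_D * (2 + 32 * K) ^ 2) (by norm_num : (0:ℝ) < 1 / 2), hsd]
      with β h1 h2 h3 h4 h5 h6 h7 h8 h9 h10 h11 h12 h13 h14 h15 h16 hg U hU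
    obtain ⟨hlo, hhi⟩ := fpWeight_core_at L hL hK hSP hMT hεT hT hC hI hKD hD hB0 hB hM rfl (hδ0 β) hg.1 hg.2
      h1 h2 h3 h4 h5 h6 h7 h8 h9 h10 h11 h12 h13 h14 h15 h16 hU
    rw [← hClo] at hlo
    rw [← hChi] at hhi
    have hbar0 := (fpWeightBar_pos L hg.1).le
    have ht2 : 0 ≤ δ β ^ 2 := sq_nonneg _
    constructor
    · refine le_trans (mul_le_mul_of_nonneg_left ?_ hbar0) hlo
      nlinarith only [mul_nonneg hChi0 ht2]
    · refine hhi.trans (mul_le_mul_of_nonneg_left ?_ hbar0)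
      nlinarith only [mul_nonneg hClo0 ht2]
  obtain ⟨β₀, hβ₀⟩ := Filter.eventually_atTop.mp ev
  exact ⟨Clo + Chi, β₀, add_nonneg hClo0 hChi0, fun β hβ U hU => hβ₀ β hβ U hU⟩

/-! ## §2 ★★★ The record instance `δ = β^{-σ}`, `δg = β^{-1}`, `0 < σ ≤ 1/3` -/

/-- `powScale σ → 0` for `σ > 0`. [folklore] -/
theorem tendsto_powScale {σ : ℝ} (hσ : 0 < σ) : Tendsto (powScale σ) atTop (𝓝 0) := by
  refine Metric.tendsto_atTop.mpr fun e he => ?_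
  obtain ⟨β₀, hβ₀⟩ := powScale_eventually_le hσ (half_pos he)
  refine ⟨β₀, fun β hβ => ?_⟩
  rw [dist_zero_right, Real.norm_eq_abs, abs_of_pos (powScale_pos σ β)]
  linarith [hβ₀ β hβ]

/-- For `β ≥ 1` and `3σ ≤ 1`: `β^{-1} ≤ (β^{-σ})³`. [folklore] -/
theorem powScale_one_le_cube {σ β : ℝ} (hσ3 : σ ≤ 1 / 3) (hβ : 1 ≤ β) : powScale 1 β ≤ powScale σ β ^ 3 := by
  rw [powScale_eq hβ, powScale_eq hβ, ← Real.rpow_mul_natCast (by linarith) (-σ) 3]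
  exact Real.rpow_le_rpow_of_exponent_le hβ (by push_cast; linarith)

/-- ★★★ **THE RECORD INSTANCE**: with core radius `β^{-σ}` (`0 < σ ≤ 1/3`, e.g. the window `σ ∈ (1/6, 1/5)`), fat radius `M β^{-σ}` (`M ≥ M₀(L)`) and gauge width `β^{-1}`, the
Faddeev–Popov weight `N = gaugeAvg (recordWeightRho …)` is constant on the fat tube to relative `O(β^{-2σ})`. [cite: Luscher1983, §3] -/
theorem fpWeight_core_constant_pow (hL : Nonempty (NzSite L)) {σ : ℝ} (hσ0 : 0 < σ) (hσ3 : σ ≤ 1 / 3) :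
    ∃ M₀ : ℝ, 2 ≤ M₀ ∧ ∀ M : ℝ, M₀ ≤ M → ∃ C β₀ : ℝ, 0 ≤ C ∧ ∀ β : ℝ, β₀ ≤ β →
      ∀ U ∈ fatTubeRho L (powScale σ) (fun b => M * powScale σ b) β,
        fpWeightBar L (powScale 1 β) * (1 - C * powScale σ β ^ 2) ≤
            gaugeAvg (recordWeightRho L (powScale σ) (fun b => M * powScale σ b) (powScale 1) β) U ∧
          gaugeAvg (recordWeightRho L (powScale σ) (fun b => M * powScale σ b) (powScale 1) β) U ≤
            fpWeightBar L (powScale 1 β) * (1 + C * powScale σ β ^ 2) := by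
  refine fpWeight_core_constant L hL (fun β => powScale_pos σ β) (tendsto_powScale hσ0) ?_
  filter_upwards [Filter.eventually_ge_atTop (1 : ℝ)] with β hβ
  exact ⟨powScale_pos 1 β, powScale_one_le_cube hσ3 hβ⟩

end Summit.QuantumFields.YangMills.Theorems.FemtoTransferGap.TwoLattice.ConstTube

end
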